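import Summits.BirchSwinnertonDyer.Rank1Residual.X11b.Three.RouteR1Tamagawa
import Summits.BirchSwinnertonDyer.Rank1Residual.Additive.CyclotomicPrimeMultiplicativeReduction
import Literature.NumberTheory.EllipticCurves.PAdicBSDSplitMultiplicativeProofs
import HarnessLib

/-!
# Route `ErratumRoadFive` (rung K2), the IMC («⊂») road WITHOUT the (ram)-at-`q` binder — link (C) of Castella's §5 descent
# on an erratum field needs only that `q` be NON-SPLIT multiplicative, not that `E[p]` be ramified at `q`
# (cell `bsd-stepL`, seat `bsd-stepL-imc-p1` g26; `--supports stmt-BirchSwinnertonDyer-23253`; memo `imc-p1/g26/RAMFREE-ROAD-imc-p1-g26.md`)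

Link (C) of [Cas18, §5] — `ord_p ∏_w c_w(E/K) = ord_p ∏_ℓ c_ℓ(E) + ord_p ∏_ℓ c_ℓ(E^{(d_K)})` on an erratum field `K` for the
non-split multiplicative prime `q` (`q ∣ d_K`, every other bad prime split, `2` split if `2 ∤ N`) — is in the tree as
`X11b.Three.tamagawaDescentAt_of_isErratumField_odd` (x11b3) ∕ `tamagawaDescentAt_of_isErratumField` (multr1-p1) under the
hypothesis `p ∤ ord_q(Δ_min)` («`E[p]` ramified at `q`»), used there ONLY through the uniform `j`-criterion
`padicValNat_localTamagawaNumber_eq_zero_of_semistable` at the place `q` and at the place of `K` above it. That hypothesis is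
NOT needed: `E` is NON-SPLIT multiplicative at `q` (`c_q ∈ {1, 2}`, Tate's algorithm Step 2,
`localTamagawaNumber_of_hasNonsplitMultiplicativeReductionAt_holds`), the place `w ∣ q` of `K` is ramified of residue degree one
(`N(w) = q`: `e = 2`, `f = 1`, `HeegnerIdeal.exists_prime_of_dvd_discr`), so `E_K` is STILL non-split multiplicative at `w`
(`Additive.not_hasSplitMultiplicativeReductionAt_baseChange_of_not_split_prime`: the node-tangent quadratic does not acquire a root
in `k_w = 𝔽_q`) with `c_w ∈ {1, 2}`, and `E^{(d_K)}` has Kodaira type `I_n^*` at `q` with `c ∈ {1, 2, 4}`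
(`Additive.tamagawaNumberAt_twist_of_semistable_mem`) — all prime to every odd `p`, whatever `ord_q(Δ_min)`.

* `padicValNat_localTamagawaNumber_eq_zero_of_not_split` — `p ∤ c_w` (odd `p`) at a NON-SPLIT multiplicative place.
* `not_hasSplitMultiplicativeReductionAt_of_primesEquiv_eq` — prime-indexed ⟹ place-indexed non-splitness over `ℚ`.
* `padicValNat_sum_fibre_eq_of_isErratumField_nonsplit` — the per-place identity of `RouteR1TamagawaPlaces` with
  `hvq : ¬ p ∣ ord_q(Δ_min)` REPLACED by `hnsq : ¬ split-multiplicative at q` (proof verbatim elsewhere).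
* `tamagawaDescentAt_of_isErratumField_nonsplit` — `TamagawaDescentAt W p K Wd` for every odd `p`, odd non-split
  multiplicative `q`, erratum field `K` for `q`, elliptic model `Wd` of `E^{(d_K)}`; and the twist identity
  `padicValNat_tamagawaProduct_twist_eq_of_isErratumField_nonsplit`.

Use (K2, «RAMFREE-ROAD»): use (U4) of the kernel audit — the only arithmetic (non-statement) use of `E[p]`-ramification at
`q` on the erratum road (`KernelFromPrintB.missingLowerBoundAt_of_erratumHypotheses_of_…`, via `tamagawaDescentAt_of_isErratumField`)
— is discharged under the road's own binder `¬ W.HasSplitMultiplicativeReductionAtPrime q`. HONEST FRAMING: elementary local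
arithmetic (THEOREMS ONLY, no definition, no named fact, no `sorry`); nothing about L-functions or Selmer groups; no item
closes; BSD is proved for no pair; closes: none (T7).

References: [Castella2018] §5 (arXiv:1704.06608 p. 12), Tamagawa relation; [SilvermanATAEC1994] IV.9.4 Step 2 (non-split `I_n`:
`c ∈ {1,2}`), Steps 6–7; [SilvermanAEC2009] VII.5 Prop. 5.1(b), VII.1 Prop. 1.3(b); [Marcus2018] Ch. 3 Thm. 25 (`N(w) = q` at a
ramified prime of a quadratic field).
-/

noncomputable section

open scoped Classical

open WeierstrassCurve NumberField IsDedekindDomain Literature.NumberTheory.EllipticCurves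
  Literature.NumberTheory.EllipticCurves.Rank1Residual
  Summit.BirchSwinnertonDyer.Rank1Residual Summit.BirchSwinnertonDyer.Rank1Residual.X11b
  Summit.BirchSwinnertonDyer.Rank1Residual.X11b.Three

-- the cell's Theorems namespace repeats the summit name (Summit.<Summit>.<Problem>), as in every sibling file
set_option linter.dupNamespace false
set_option autoImplicit false

namespace Summit.BirchSwinnertonDyer.BirchSwinnertonDyer.Theorems.RamFree

/-! ### §1 Two local lemmas -/

/-- **`p ∤ c_w` at a NON-SPLIT multiplicative place, `p` odd**: for an elliptic curve `X` over a number field `F` and a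
finite place `w` of non-split multiplicative reduction, `c_w ∈ {1, 2}` (Tate's algorithm Step 2,
`localTamagawaNumber_of_hasNonsplitMultiplicativeReductionAt_holds`), hence `ord_p c_w = 0` for every odd prime `p` — NO
hypothesis on `ord_w(Δ_min)`. [cite: SilvermanATAEC1994, IV.9.4 Step 2 (PDF p. 344)] -/
theorem padicValNat_localTamagawaNumber_eq_zero_of_not_split {F : Type*} [Field F] [NumberField F]
    (X : WeierstrassCurve F) [X.IsElliptic] (w : HeightOneSpectrum (𝓞 F)) {p : ℕ} [Fact p.Prime] (hp2 : p ≠ 2)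
    (hmult : X.HasMultiplicativeReductionAt w) (hns : ¬ X.HasSplitMultiplicativeReductionAt w) :
    padicValNat p ((X.baseChange (w.adicCompletion F)).localTamagawaNumber (w.adicCompletionIntegers F)) = 0 := by
  have hpP : p.Prime := Fact.out
  haveI : Finite (IsLocalRing.ResidueField (w.adicCompletionIntegers F)) :=
    HeightOneSpectrum.finite_residueField_adicCompletionIntegers F w
  refine padicValNat.eq_zero_of_not_dvd fun hdvd => ?_
  rw [localTamagawaNumber_of_hasNonsplitMultiplicativeReductionAt_holds w X hmult hns] at hdvd
  split_ifs at hdvd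
  · exact hp2 ((Nat.prime_dvd_prime_iff_eq hpP Nat.prime_two).mp hdvd)
  · exact hpP.one_lt.ne' (Nat.dvd_one.mp hdvd)

/-- **Prime-indexed non-splitness gives place-indexed non-splitness over `ℚ`**: if `E/ℚ` is not split multiplicative at
the rational prime `q` (`HasSplitMultiplicativeReductionAtPrime`, the `ℤ_[q]`-minimal model) and `v` is the place of `ℚ`
with `primesEquiv v = q`, then `E` is not split multiplicative at `v` (the chosen `𝓞_v`-minimal model) —
`hasSplitMultiplicativeReductionAtPrime_iff_hasSplitMultiplicativeReductionAt` re-indexed by the pair `(v, q)`.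
[cite: SilvermanAEC2009, VII.5 Prop. 5.1(b) (PDF p. 174) and VII.1 Prop. 1.3(b)] -/
theorem not_hasSplitMultiplicativeReductionAt_of_primesEquiv_eq (W : WeierstrassCurve ℚ) [W.IsElliptic]
    (v : HeightOneSpectrum (𝓞 ℚ)) {q : ℕ} [Fact q.Prime] (hv : (Rat.HeightOneSpectrum.primesEquiv v : ℕ) = q)
    (hns : ¬ W.HasSplitMultiplicativeReductionAtPrime q) : ¬ W.HasSplitMultiplicativeReductionAt v := by
  subst hv
  rw [← W.hasSplitMultiplicativeReductionAtPrime_iff_hasSplitMultiplicativeReductionAt v]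
  exact hns

/-! ### §2 The per-place identity on an erratum field, `hvq` replaced by non-splitness at `q` -/

/-- **The Tamagawa relation, one rational place at a time, at an ODD prime `p` on an ERRATUM field for a NON-SPLIT
multiplicative odd `q` — WITHOUT `p ∤ ord_q(Δ_min)`.** `X11b.Three.padicValNat_sum_fibre_eq_of_isErratumField` VERBATIM
(split `v`: two degree-one places, `d_K ∈ (ℚ_ℓ^×)²`; non-split `v ↔ ℓ`: `E` good at `ℓ`, or `ℓ = q`; the twist good at
`ℓ ∤ d_K` and of type `I₀*`∕`Iₙ*` with `c ∈ {1,2,4}` at `ℓ ∣ d_K`) EXCEPT at the one place where that proof used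
`hvq`: for `ℓ = q`, `c_q(E) ∈ {1,2}` and `c_w(E_K) ∈ {1,2}` because BOTH reductions are NON-SPLIT multiplicative (`N(w) = q`
at the ramified `w ∣ q`, `Additive.not_hasSplitMultiplicativeReductionAt_baseChange_of_not_split_prime`).
[cite: Castella2018, §5 (arXiv:1704.06608 p. 12), Tamagawa relation]
[cite: SilvermanATAEC1994, IV.9.4 Steps 2, 6–7 (PDF pp. 344–346)] [cite: Marcus2018, Ch. 3, Thm. 25] -/
theorem padicValNat_sum_fibre_eq_of_isErratumField_nonsplit (W : WeierstrassCurve ℚ) [W.IsElliptic]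
    [W.IsGloballyMinimal] (p : ℕ) [Fact p.Prime] (hp2 : p ≠ 2) (K : Type) [Field K] [NumberField K]
    [(W.baseChange K).IsElliptic] {q : ℕ} [Fact q.Prime] (hq2 : q ≠ 2) (hmq : Mult W q)
    (hnsq : ¬ W.HasSplitMultiplicativeReductionAtPrime q) (hK : IsErratumField W K q)
    (Wd : WeierstrassCurve ℚ) [Wd.IsElliptic] {C : VariableChange ℚ}
    (hC : C • W.quadraticTwist (NumberField.discr K : ℚ) = Wd) (v : HeightOneSpectrum (𝓞 ℚ)) :
    (∑ w ∈ (HeightOneSpectrum.finite_setOf_under_eq_of_numberField (K := K) v).toFinset,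
        padicValNat p (((W.baseChange K).baseChange (w.adicCompletion K)).localTamagawaNumber
          (w.adicCompletionIntegers K)) =
      padicValNat p ((W.baseChange (v.adicCompletion ℚ)).localTamagawaNumber
          (v.adicCompletionIntegers ℚ)) +
        padicValNat p ((Wd.baseChange (v.adicCompletion ℚ)).localTamagawaNumber
          (v.adicCompletionIntegers ℚ))) ∧
    padicValNat p ((Wd.baseChange (v.adicCompletion ℚ)).localTamagawaNumber
        (v.adicCompletionIntegers ℚ)) =
      padicValNat p ((W.baseChange (v.adicCompletion ℚ)).localTamagawaNumber
        (v.adicCompletionIntegers ℚ)) := by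
  have hpr : p.Prime := Fact.out
  have hqP : q.Prime := Fact.out
  have h2 : Module.finrank ℚ K = 2 := hK.1.1
  set ℓ : ℕ := (Rat.HeightOneSpectrum.primesEquiv v : ℕ) with hℓdef
  haveI hℓ : Fact ℓ.Prime := ⟨(Rat.HeightOneSpectrum.primesEquiv v).2⟩
  have hvℓ : (Rat.HeightOneSpectrum.primesEquiv v : ℕ) = ℓ := rfl
  have hd : (NumberField.discr K : ℚ) ≠ 0 := by exact_mod_cast NumberField.discr_ne_zero K
  have hdZ : (NumberField.discr K : ℤ) ≠ 0 := NumberField.discr_ne_zero K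
  have hfin := HeightOneSpectrum.finite_setOf_under_eq_of_numberField (K := K) v
  -- `d_K ≡ 1 (mod 8)` and `2 ∤ d_K` on an erratum field at an odd `q`
  have h8 : NumberField.discr K % 8 = 1 := hK.discr_emod_eight hq2
  have hodd2 : ¬ (2 : ℤ) ∣ NumberField.discr K := (hK.not_two_dvd_discr_iff).mpr hq2
  -- the case of a single place `w` above `v` (inert or ramified): all three numbers are `p`-units
  have key : ∀ w : HeightOneSpectrum (𝓞 K), {w' : HeightOneSpectrum (𝓞 K) | w'.under (𝓞 ℚ) = v} = {w} →
      (∑ w ∈ hfin.toFinset,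
          padicValNat p (((W.baseChange K).baseChange (w.adicCompletion K)).localTamagawaNumber
            (w.adicCompletionIntegers K)) =
        padicValNat p ((W.baseChange (v.adicCompletion ℚ)).localTamagawaNumber
            (v.adicCompletionIntegers ℚ)) +
          padicValNat p ((Wd.baseChange (v.adicCompletion ℚ)).localTamagawaNumber
            (v.adicCompletionIntegers ℚ))) ∧
      padicValNat p ((Wd.baseChange (v.adicCompletion ℚ)).localTamagawaNumber
          (v.adicCompletionIntegers ℚ)) =
        padicValNat p ((W.baseChange (v.adicCompletion ℚ)).localTamagawaNumber
          (v.adicCompletionIntegers ℚ)) := by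
    intro w hset
    have hw : w.under (𝓞 ℚ) = v := by
      have h : w ∈ ({w} : Set (HeightOneSpectrum (𝓞 K))) := Set.mem_singleton _
      rwa [← hset] at h
    haveI : w.asIdeal.LiesOver v.asIdeal := ⟨by rw [← hw]; rfl⟩
    have hF : hfin.toFinset = {w} := by
      ext w'
      rw [Set.Finite.mem_toFinset, hset]
      simp
    -- `ℓ` does not split in `K`
    have hns : ¬ SplitsIn K ℓ := by
      show ((Ideal.span {(ℓ : ℤ)}).primesOver (𝓞 K)).ncard ≠ 2
      rw [hℓdef, ncard_primesOver_span_eq K v, hset, Set.ncard_singleton]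
      decide
    -- so a bad `ℓ` is the ramified prime `q`
    have hℓq : ℓ ∣ W.conductorNorm ℤ → ℓ = q := fun hℓN => by
      by_contra hne
      exact hns (hK.2.2.1 ℓ hℓ.out hℓN hne)
    -- `E` is semistable at `v`, with the `p`-adic `j`-hypothesis
    have hsemiW : W.HasGoodReductionAt v ∨ W.HasMultiplicativeReductionAt v := by
      by_cases hℓN : ℓ ∣ W.conductorNorm ℤ
      · exact Or.inr ((hasMultiplicativeReductionAtPrime_primesEquiv_iff_holds W v q (hℓq hℓN)).mp hmq)
      · exact Or.inl ((hasGoodReductionAtPrime_primesEquiv_iff_holds W v ℓ hvℓ).mp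
          (by
            by_contra hbad'
            exact hℓN ((W.dvd_conductorNorm_iff_not_hasGoodReductionAtPrime ℓ).mpr hbad')))
    -- `c_v(E)` and `c_w(E_K)` are `p`-units: good places have `c = 1`; at `ℓ = q` BOTH curves have NON-SPLIT
    -- multiplicative reduction (`K_w/ℚ_q` has residue degree one), so `c ∈ {1, 2}` — no hypothesis on `ord_q(Δ_min)`
    have hQK : padicValNat p ((W.baseChange (v.adicCompletion ℚ)).localTamagawaNumber
          (v.adicCompletionIntegers ℚ)) = 0 ∧
        padicValNat p (((W.baseChange K).baseChange (w.adicCompletion K)).localTamagawaNumber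
          (w.adicCompletionIntegers K)) = 0 := by
      by_cases hℓN : ℓ ∣ W.conductorNorm ℤ
      · have hmv : W.HasMultiplicativeReductionAt v :=
          (hasMultiplicativeReductionAtPrime_primesEquiv_iff_holds W v q (hℓq hℓN)).mp hmq
        have hnsv : ¬ W.HasSplitMultiplicativeReductionAt v :=
          not_hasSplitMultiplicativeReductionAt_of_primesEquiv_eq W v (hℓq hℓN) hnsq
        have hvq' : v = (Rat.HeightOneSpectrum.primesEquiv (R := 𝓞 ℚ)).symm ⟨q, hqP⟩ := by
          rw [Equiv.eq_symm_apply]; exact Subtype.ext (hℓq hℓN)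
        have hqv : (q : 𝓞 ℚ) ∈ v.asIdeal :=
          (natCast_mem_asIdeal_iff_eq_primesEquiv_symm v hqP).mpr hvq'
        have hmem : (q : 𝓞 ℚ) ∈ (w.under (𝓞 ℚ)).asIdeal := by rw [hw]; exact hqv
        rw [HeightOneSpectrum.under_asIdeal, Ideal.under_def, Ideal.mem_comap, map_natCast] at hmem
        have hmK := Additive.isMinimalAt_and_hasMultiplicativeReductionAt_baseChange_of_mult W hmq w hmem
        -- `N(w) = q`: `q ∣ d_K` is ramified in the quadratic field `K` (`e = 2`, `f = 1`), and `w` is THE place above `q`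
        have hN : Ideal.absNorm w.asIdeal = q := by
          obtain ⟨P, hPprime, hPover, -, hf1⟩ := HeegnerIdeal.exists_prime_of_dvd_discr h2 hqP hK.2.1
          haveI := hPover
          have hNP : Ideal.absNorm P = q := by
            rw [Ideal.absNorm_eq_pow_inertiaDeg' P hqP, hf1, pow_one]
          have hP0 : P ≠ ⊥ := by
            intro h0
            rw [h0, Ideal.absNorm_bot] at hNP
            exact hqP.ne_zero hNP.symm
          let wP : HeightOneSpectrum (𝓞 K) := ⟨P, hPprime, hP0⟩
          have hqPmem : ((q : ℤ) : 𝓞 K) ∈ P := by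
            have h := Ideal.mem_span_singleton_self (q : ℤ)
            rw [hPover.over, Ideal.under_def, Ideal.mem_comap] at h
            simpa using h
          have hm : (q : 𝓞 ℚ) ∈ (wP.under (𝓞 ℚ)).asIdeal := by
            rw [HeightOneSpectrum.under_asIdeal, Ideal.under_def, Ideal.mem_comap, map_natCast]
            simpa using hqPmem
          have hunder : wP.under (𝓞 ℚ) = v :=
            ((natCast_mem_asIdeal_iff_eq_primesEquiv_symm (wP.under (𝓞 ℚ)) hqP).mp hm).trans hvq'.symm
          have hwPw : wP = w := by
            have hin : wP ∈ ({w' : HeightOneSpectrum (𝓞 K) | w'.under (𝓞 ℚ) = v} : Set _) := hunder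
            rw [hset, Set.mem_singleton_iff] at hin
            exact hin
          rw [← hwPw]
          exact hNP
        have hnsK : ¬ (W.baseChange K).HasSplitMultiplicativeReductionAt w :=
          Additive.not_hasSplitMultiplicativeReductionAt_baseChange_of_not_split_prime W q w hmem hN hmq hnsq
        exact ⟨padicValNat_localTamagawaNumber_eq_zero_of_not_split W v hp2 hmv hnsv,
          padicValNat_localTamagawaNumber_eq_zero_of_not_split (W.baseChange K) w hp2 hmK.2 hnsK⟩
      · have hgood : W.HasGoodReductionAt v :=
          (hasGoodReductionAtPrime_primesEquiv_iff_holds W v ℓ hvℓ).mp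
            (by
              by_contra hbad'
              exact hℓN ((W.dvd_conductorNorm_iff_not_hasGoodReductionAtPrime ℓ).mpr hbad'))
        have hgoodK := hasGoodReductionAt_baseChange_of_hasGoodReductionAt_rat W v w hgood
        refine ⟨?_, ?_⟩
        · rw [localTamagawaNumber_eq_one_of_good' v W
            (WeierstrassCurve.localTamagawaNumber_eq_one_of_hasGoodReduction_holds _ _) hgood]
          simp
        · rw [localTamagawaNumber_eq_one_of_good' w (W.baseChange K)
            (WeierstrassCurve.localTamagawaNumber_eq_one_of_hasGoodReduction_holds _ _) hgoodK]
          simp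
    have hQ := hQK.1
    have hKw := hQK.2
    -- the twist at `v`
    have hD : padicValNat p ((Wd.baseChange (v.adicCompletion ℚ)).localTamagawaNumber
        (v.adicCompletionIntegers ℚ)) = 0 := by
      by_cases hℓd : ((Rat.HeightOneSpectrum.primesEquiv v : ℕ) : ℤ) ∣ NumberField.discr K
      · -- ramified `ℓ ∣ d_K`: `ℓ` odd, `ℓ ∥ d_K`, twist of Kodaira type `I₀*`/`Iₙ*`, `c ∈ {1, 2, 4}`
        have hℓ2 : (Rat.HeightOneSpectrum.primesEquiv v : ℕ) ≠ 2 := by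
          intro h
          apply hodd2
          have h' : (((Rat.HeightOneSpectrum.primesEquiv v : ℕ) : ℤ)) = 2 := by rw [h]; rfl
          rwa [h'] at hℓd
        have hsq : ¬ ((Rat.HeightOneSpectrum.primesEquiv v : ℕ) : ℤ) ^ 2 ∣ NumberField.discr K :=
          Literature.NumberTheory.QuadraticFields.Quadratic.not_sq_dvd_discr_of_prime_ne_two h2
            hℓ.out hℓ2
        have hmem := Additive.tamagawaNumberAt_twist_of_semistable_mem v W hℓ2 hdZ hℓd hsq hsemiW
          C hC
        rw [tamagawaNumberAt_def] at hmem
        have h4 : ¬ p ∣ 4 := fun h => hp2 ((Nat.prime_dvd_prime_iff_eq hpr Nat.prime_two).mp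
          (hpr.dvd_of_dvd_pow (show p ∣ 2 ^ 2 by simpa using h)))
        have h2' : ¬ p ∣ 2 := fun h => hp2 ((Nat.prime_dvd_prime_iff_eq hpr Nat.prime_two).mp h)
        rcases hmem with h | h | h <;> rw [h]
        · simp
        · exact padicValNat.eq_zero_of_not_dvd h2'
        · exact padicValNat.eq_zero_of_not_dvd h4
      · -- unramified `ℓ ∤ d_K`: `E` is good at `v` (a bad `ℓ` would be `q ∣ d_K`), so is the twist
        have hℓN : ¬ ℓ ∣ W.conductorNorm ℤ := fun hℓN => by
          apply hℓd
          rw [hvℓ, hℓq hℓN]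
          exact hK.2.1
        have hgood : W.HasGoodReductionAt v :=
          (hasGoodReductionAtPrime_primesEquiv_iff_holds W v ℓ hvℓ).mp
            (by
              by_contra hbad'
              exact hℓN ((W.dvd_conductorNorm_iff_not_hasGoodReductionAtPrime ℓ).mpr hbad'))
        have hDk : NumberField.discr K = 4 * ((NumberField.discr K - 1) / 4) + 1 := by omega
        have hgoodd : Wd.HasGoodReductionAt v :=
          X2.hasGoodReductionAt_twist_of_not_dvd W v hDk hℓd hgood C hC
        rw [localTamagawaNumber_eq_one_of_good' v Wd
          (WeierstrassCurve.localTamagawaNumber_eq_one_of_hasGoodReduction_holds _ _) hgoodd]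
        simp
    rw [hF, Finset.sum_singleton, hKw, hQ, hD]
    exact ⟨rfl, rfl⟩
  rcases placesOver_trichotomy_of_finrank_eq_two K h2 v with
    ⟨w₁, w₂, hne, hset, hef⟩ | ⟨w, hset, -, -⟩ | ⟨w, hset, -, -⟩
  · -- split: two places of degree one, and `d_K` is a square in `ℚ_ℓ`
    have hw₁ : w₁.under (𝓞 ℚ) = v := by
      have h : w₁ ∈ ({w₁, w₂} : Set (HeightOneSpectrum (𝓞 K))) := Set.mem_insert _ _
      rwa [← hset] at h
    have hw₂ : w₂.under (𝓞 ℚ) = v := by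
      have h : w₂ ∈ ({w₁, w₂} : Set (HeightOneSpectrum (𝓞 K))) :=
        Set.mem_insert_of_mem _ (Set.mem_singleton _)
      rwa [← hset] at h
    obtain ⟨he₁, hf₁⟩ := hef w₁ hw₁
    obtain ⟨he₂, hf₂⟩ := hef w₂ hw₂
    have hF : hfin.toFinset = {w₁, w₂} := by
      ext w
      rw [Set.Finite.mem_toFinset, hset]
      simp
    have hs : SplitsIn K ℓ := by
      show ((Ideal.span {(ℓ : ℤ)}).primesOver (𝓞 K)).ncard = 2
      rw [hℓdef, ncard_primesOver_span_eq K v, hset, Set.ncard_pair hne]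
    have hsq := isSquare_padic_discr_of_splitsIn h2 hs
    have c₁ := localTamagawaNumber_baseChange_eq_of_degree_one W w₁ he₁ hf₁
    have c₂ := localTamagawaNumber_baseChange_eq_of_degree_one W w₂ he₂ hf₂
    rw [hw₁] at c₁
    rw [hw₂] at c₂
    rw [hF, Finset.sum_pair hne, c₁, c₂,
      localTamagawaNumber_eq_of_twist_of_isSquare W v hvℓ hd hsq Wd hC]
    exact ⟨rfl, rfl⟩
  · exact key w hset
  · exact key w hset


/-! ### §3 Link (C) assembled -/

/-- `ord_p` of a finite product of non-zero naturals is the sum of the `ord_p`. [folklore] -/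
private theorem padicValNat_finsetProd {ι : Type*} (p : ℕ) [Fact p.Prime] (s : Finset ι)
    (f : ι → ℕ) (hf : ∀ i ∈ s, f i ≠ 0) :
    padicValNat p (∏ i ∈ s, f i) = ∑ i ∈ s, padicValNat p (f i) := by
  classical
  induction s using Finset.induction_on with
  | empty => simp
  | insert a s ha ih =>
    rw [Finset.prod_insert ha, Finset.sum_insert ha,
      padicValNat.mul (hf a (Finset.mem_insert_self a s))
        (Finset.prod_ne_zero_iff.mpr fun i hi => hf i (Finset.mem_insert_of_mem hi)),
      ih fun i hi => hf i (Finset.mem_insert_of_mem hi)]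

/-- **Link (C) of route R1 ∕ the erratum road at every ODD prime on an erratum field at an ODD NON-SPLIT multiplicative `q`,
with NO hypothesis on `ord_q(Δ_min)`** (`TamagawaDescentAt W p K Wd` of `CastellaErratum.lean`): for `W/ℚ` globally minimal
elliptic, an odd prime `p`, an odd prime `q` of NON-SPLIT multiplicative reduction, an erratum field `K` for `q` and any
elliptic model `Wd` of `E^{(d_K)}`: `ord_p ∏_w c_w(E/K) = ord_p ∏_ℓ c_ℓ(E) + ord_p ∏_ℓ c_ℓ(E^{(d_K)})`. Drop-in for
`tamagawaDescentAt_of_isErratumField` ∕ `…_odd` on the ram-free erratum road (memo RAMFREE-ROAD, use (U4)).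
[cite: Castella2018, §5 (arXiv:1704.06608 p. 12), Tamagawa relation]
[cite: Castella2018Erratum, Thm. 1.1 (iii) (p. 1: «nonsplit multiplicative reduction at each prime q ∥ N which is nonsplit in K»)] -/
theorem tamagawaDescentAt_of_isErratumField_nonsplit (W : WeierstrassCurve ℚ) [W.IsElliptic]
    [W.IsGloballyMinimal] (p : ℕ) [Fact p.Prime] (hp2 : p ≠ 2) (q : ℕ) [Fact q.Prime] (hq2 : q ≠ 2)
    (hmq : Mult W q) (hnsq : ¬ W.HasSplitMultiplicativeReductionAtPrime q)
    (K : Type) [Field K] [NumberField K] (hK : IsErratumField W K q)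
    (Wd : WeierstrassCurve ℚ) [Wd.IsElliptic]
    (hWd : ∃ C : VariableChange ℚ, C • W.quadraticTwist (NumberField.discr K : ℚ) = Wd) :
    TamagawaDescentAt W p K Wd := by
  obtain ⟨C, hC⟩ := hWd
  haveI hEK : (W.baseChange K).IsElliptic := by rw [baseChange]; infer_instance
  exact padicValNat_tamagawaProduct_baseChange_of_fibrewise W p K Wd fun v =>
    (padicValNat_sum_fibre_eq_of_isErratumField_nonsplit W p hp2 K hq2 hmq hnsq hK Wd hC v).1

/-- **`ord_p ∏_ℓ c_ℓ(E^{(d_K)}) = ord_p ∏_ℓ c_ℓ(E)`** at every odd `p` on an erratum field at an odd NON-SPLIT multiplicative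
`q`, no hypothesis on `ord_q(Δ_min)` (the twist half, assembled over the common finite support; twin of
`padicValNat_tamagawaProduct_twist_eq_of_isErratumField_odd`). [cite: Castella2018, §5 (arXiv:1704.06608 p. 12), Tamagawa relation] -/
theorem padicValNat_tamagawaProduct_twist_eq_of_isErratumField_nonsplit (W : WeierstrassCurve ℚ)
    [W.IsElliptic] [W.IsGloballyMinimal] (p : ℕ) [Fact p.Prime] (hp2 : p ≠ 2) (q : ℕ)
    [Fact q.Prime] (hq2 : q ≠ 2) (hmq : Mult W q) (hnsq : ¬ W.HasSplitMultiplicativeReductionAtPrime q)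
    (K : Type) [Field K] [NumberField K] (hK : IsErratumField W K q)
    (Wd : WeierstrassCurve ℚ) [Wd.IsElliptic]
    (hWd : ∃ C : VariableChange ℚ, C • W.quadraticTwist (NumberField.discr K : ℚ) = Wd) :
    padicValNat p Wd.tamagawaProduct = padicValNat p W.tamagawaProduct := by
  obtain ⟨C, hC⟩ := hWd
  haveI hEK : (W.baseChange K).IsElliptic := by rw [baseChange]; infer_instance
  set cQ : HeightOneSpectrum (𝓞 ℚ) → ℕ := fun v =>
    (W.baseChange (v.adicCompletion ℚ)).localTamagawaNumber (v.adicCompletionIntegers ℚ) with hcQ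
  set cD : HeightOneSpectrum (𝓞 ℚ) → ℕ := fun v =>
    (Wd.baseChange (v.adicCompletion ℚ)).localTamagawaNumber (v.adicCompletionIntegers ℚ) with hcD
  have hfinQ : (Function.mulSupport cQ).Finite := W.mulSupport_localTamagawaNumber_finite_holds
  have hfinD : (Function.mulSupport cD).Finite := Wd.mulSupport_localTamagawaNumber_finite_holds
  set S : Finset (HeightOneSpectrum (𝓞 ℚ)) := hfinQ.toFinset ∪ hfinD.toFinset with hS
  have hsubQ : Function.mulSupport cQ ⊆ ↑S := fun v hv => by
    rw [Finset.mem_coe, hS, Finset.mem_union]; exact Or.inl (hfinQ.mem_toFinset.mpr hv)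
  have hsubD : Function.mulSupport cD ⊆ ↑S := fun v hv => by
    rw [Finset.mem_coe, hS, Finset.mem_union]; exact Or.inr (hfinD.mem_toFinset.mpr hv)
  rw [show Wd.tamagawaProduct = ∏ᶠ v, cD v from rfl, show W.tamagawaProduct = ∏ᶠ v, cQ v from rfl,
    finprod_eq_prod_of_mulSupport_subset cD hsubD, finprod_eq_prod_of_mulSupport_subset cQ hsubQ,
    padicValNat_finsetProd p S cD fun v _ => Wd.localTamagawaNumber_baseChange_ne_zero v,
    padicValNat_finsetProd p S cQ fun v _ => W.localTamagawaNumber_baseChange_ne_zero v]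
  exact Finset.sum_congr rfl fun v _ =>
    (padicValNat_sum_fibre_eq_of_isErratumField_nonsplit W p hp2 K hq2 hmq hnsq hK Wd hC v).2

end Summit.BirchSwinnertonDyer.BirchSwinnertonDyer.Theorems.RamFree

end
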